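import Summits.BirchSwinnertonDyer.BirchSwinnertonDyer.Theorems.AlignedTransportAtTwoMainConjectureOfRankZeroBSDAtTwoCubicChevalleyUnitSign
import Summits.BirchSwinnertonDyer.BirchSwinnertonDyer.Theorems.AlignedTransportAtTwoMainConjectureOfRankZeroBSDAtTwoCubicOffStratumFukudaIndexDoors
import HarnessLib

/-!
# Route `AlignedTransportAtTwo`, crux C2 `MainConjectureOfRankZeroBSDAtTwo` (stmt-BirchSwinnertonDyer-22298):
# CHEVALLEY'S `(0,1)` DOOR OFF THE STRATUM WITH THE UNIT BIT KERNEL-DECIDABLE — on the cubic class-group road the only displayed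
# non-PRINT input that is not an integer condition is now the parity of `h(ℚ(β))`

HONEST FRAMING (cell `bsd-f1-sign2`, WIDTH-5 attached prover seat `bsd-line-att-p5` gen 29 on line `birth` of the lead `bsd-line-att-p2`;
`--supports` stmt-BirchSwinnertonDyer-22298, closes nothing; BSD is NOT proved by any of this; the crux C2, its verdict «blocked-on
`Rank1Residual.GreenbergMuConjectureIrreducible`» and every registered stub are untouched). THEOREMS ONLY — no definition, no named fact,
no `sorry`. Sequel of `…CubicChevalleyUnitSign` (the sign certificate for any cubic `2`-torsion field): specialised to att-p5's carrier `ℚ(β)`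
(`β` a root of `4x³ + b₂x² + 2b₄x + b₆`, `e₁ = 4β` a root of `c_W`) and composed with att-p5 g28's off-stratum Chevalley doors
(`…CubicOffStratumFukudaIndexDoors`), whose infinite hypothesis `hnn : ∀ a b : ℚ(β), ε ≠ a² − 2b²` — and, in §2, also `hεu : IsUnit ε` — are
DISCHARGED from integers: the unit `ε = P(4β)/(2^k m)` (`P ∈ ℤ[X]`), its cubic unit equation `ε³ − Tε² + Sε ∓ 1 = 0` (one field identity per
row) and its `2`-adic sign certificate `(a, m', c)` (two congruences and one divisibility, `decide`).

WHAT.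
* §1 **`forall_ne_sq_sub_two_mul_sq_adjoin_of_signCert`** (the sign certificate in `ℚ(β)`);
  **`classicalMuVanishes_adjoin_of_chevalleySign_of_not_onKilfordStratumAtTwo`** (`μ₂(ℚ(β)^cyc) = 0` OFF the stratum from `h(ℚ(β))` odd + a unit
  `ε ∈ 𝓞 ℚ(β)` with coordinates + sign certificate); **`mazurMainConjecture_two_of_muIneqRel_of_chevalleySign_of_not_onKilfordStratumAtTwo`**
  (PRINT⁵ + MuIneqʳ verbatim + cell hypotheses (`Δ_W < 0`) + the same ⟹ `MC₂(W)`).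
* §2 **`classicalMuVanishes_adjoin_of_unitCerts_of_not_onKilfordStratumAtTwo`**, **`mazurMainConjecture_two_of_muIneqRel_of_unitCerts_of_not_onKilfordStratumAtTwo`**
  (+ `…_of_minimalDiscriminantInt_emod_eight_ne_one`): the unit itself from integers — displayed per curve: PRINT⁵ + MuIneqʳ + `h(ℚ(β))` odd +
  integer data with decidable side conditions. Uniform on `Δ_min ≡ 3, 5, 7 (mod 8)`.

Which unit? For `Δ_W < 0` the cubic `ℚ(β)` is complex with unit group `±ε₀^ℤ`; `−1 = N(1 + √2)` and squares are norms, so a non-norm unit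
exists iff the fundamental unit `ε₀` is one, iff (Hasse + product formula, not kernel) its sign at the degree-one `2`-adic place is `−1`, i.e.
`σ(ε₀) ≡ ±3 (mod 8)`. CENSUS ASK (-data): for each off-stratum seed (first: 2045b1, `c_W = u³ − 3u² − 87520u − 55211200`, canonical root `≡ 3
(mod 8)`) the fundamental unit on `1, u, u²` and the parity of `h(ℚ(β))`.

CONDITIONAL theorems (PRINT⁵, MuIneqʳ displayed); nothing is asserted about any curve's class number or units; nothing is closed; BSD is not proved.

References: [Serre1973] Ch. III §1.2 Thm. 1; [Lang1990] Ch. 13 §4, Lemma 4.1; [Fukuda1994] Thm. 1 (1), p. 264; [Washington1997] §13.1;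
[Kato2004Asterisque] Thm. 17.4 (1)(2); [GreenbergLNM1716] Thm. 4.1, Conj. 1.11; [Iwasawa1973MuInvariants] Thm. 2/3; tree: att-p5 g28 p757752
`…CubicOffStratumFukudaIndexDoors`, g24 p739408 `…CubicCarrierRoad`, bsd-2adic k4-w1 `…ChevalleyDoorAtTwo`, bsd-wall `…ChevalleyPadicCertificate`.
-/

set_option linter.dupNamespace false
set_option autoImplicit false

noncomputable section

open scoped Classical NumberField nonZeroDivisors

namespace Summit.BirchSwinnertonDyer.BirchSwinnertonDyer.Theorems.AlignedTransportAtTwoCubicChevalleyUnitSignDoors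

open NumberField IsDedekindDomain Polynomial WeierstrassCurve IntermediateField
  Literature.NumberTheory.EllipticCurves Literature.NumberTheory.EllipticCurves.Greenberg1999
  Summit.BirchSwinnertonDyer.Rank1Residual.F1Sign2
  Summit.BirchSwinnertonDyer.BirchSwinnertonDyer.Theorems.AlignedTransportAtTwoBridge
  Summit.BirchSwinnertonDyer.BirchSwinnertonDyer.Theorems.AlignedTransportAtTwoKilfordStratumShared
  Summit.BirchSwinnertonDyer.BirchSwinnertonDyer.Theorems.AlignedTransportAtTwoKilfordStratum
  Summit.BirchSwinnertonDyer.BirchSwinnertonDyer.Theorems.AlignedTransportAtTwoCubicChevalleyUnitSign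

/-! ## §1 The sign certificate in `ℚ(β)` (`e₁ = 4β`) and Chevalley's doors with the unit bit in certificate form -/

section Adjoin

open CongruenceSubgroup Literature.NumberTheory.IwasawaTheory Literature.NumberTheory.GaloisRepresentations
  Literature.NumberTheory.EllipticCurves.ModularForms Literature.NumberTheory.EllipticCurves.Rank1Residual
  Literature.NumberTheory.EllipticCurves.Module
  Summit.BirchSwinnertonDyer.Rank1Residual Summit.BirchSwinnertonDyer.Rank1Residual.X1.MuLambda
  Summit.BirchSwinnertonDyer.Rank1Residual.X5
  Summit.BirchSwinnertonDyer.BirchSwinnertonDyer.Theorems.Rank1ResidualX1Defs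
  Summit.BirchSwinnertonDyer.BirchSwinnertonDyer.Theses.AlignedTransportAtTwo
  Summit.BirchSwinnertonDyer.BirchSwinnertonDyer.Theorems.AlignedTransportAtTwoCubicKilfordPrimes
  Summit.BirchSwinnertonDyer.BirchSwinnertonDyer.Theorems.AlignedTransportAtTwoCubicCarrierRoad
  Summit.BirchSwinnertonDyer.BirchSwinnertonDyer.Theorems.AlignedTransportAtTwoCubicOffStratumFukudaIndexDoors

variable (W : WeierstrassCurve ℚ) [W.IsElliptic] [W.IsGloballyMinimal]

/-- **THE SIGN CERTIFICATE IN `ℚ(β)`.** `W/ℚ` globally minimal, good ordinary at `2`, no rational `2`-torsion abscissa, `β ∈ ℚ̄` a root of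
`4x³ + b₂x² + 2b₄x + b₆` (so `u = 4β` is a root of `c_W`); `ε = P(4β)/(2^k m) ∈ ℚ(β)`. With the integers `(a, m', c)` of
`forall_ne_sq_sub_two_mul_sq_of_signCert` (two congruences and a divisibility, all decidable): `ε ≠ α² − 2β'²` for all `α, β' ∈ ℚ(β)`.
[cite: Serre1973, Ch. III §1.2 Thm. 1] [cite: NeukirchANT1999, Ch. II §8] -/
theorem forall_ne_sq_sub_two_mul_sq_adjoin_of_signCert (hord : IsOrdinaryAt W 2) (ht : ∀ x : ℚ, ¬ HasRationalTwoTorsionX W x)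
    {β : AlgebraicClosure ℚ} (hβ : aeval β W.twoTorsionPolynomial.toPoly = 0)
    (P : ℤ[X]) (k : ℕ) (m m' a c : ℤ) (hc : c = 3 ∨ c = 5) (ha : Odd a)
    (hroot : (2 : ℤ) ^ (k + 3) ∣
      a ^ 3 + (integralModelInt W).b₂ * a ^ 2 + 8 * (integralModelInt W).b₄ * a + 16 * (integralModelInt W).b₆)
    (hmm : ((m * m' : ℤ) : ZMod (2 ^ 3)) = 1)
    (hcert : ((P.eval a * m' : ℤ) : ZMod (2 ^ (k + 3))) = ((2 ^ k * c : ℤ) : ZMod (2 ^ (k + 3)))) :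
    ∀ α β' : ↥(IntermediateField.adjoin ℚ ({β} : Set (AlgebraicClosure ℚ))),
      aeval (4 * (AdjoinSimple.gen ℚ β : ↥(IntermediateField.adjoin ℚ ({β} : Set (AlgebraicClosure ℚ)))))
          (P.map (Int.castRingHom ℚ)) / (2 ^ k * (m : ↥(IntermediateField.adjoin ℚ ({β} : Set (AlgebraicClosure ℚ))))) ≠
        α ^ 2 - 2 * β' ^ 2 := by
  have hirr := AlignedTransportAtTwoSeed.irr_two_of_forall_not_hasRationalTwoTorsionX W ht
  have hβint : IsIntegral ℚ β := ((AlgebraicClosure.isAlgebraic ℚ).isAlgebraic β).isIntegral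
  haveI : FiniteDimensional ℚ ↥(IntermediateField.adjoin ℚ ({β} : Set (AlgebraicClosure ℚ))) :=
    IntermediateField.adjoin.finiteDimensional hβint
  haveI : NumberField ↥(IntermediateField.adjoin ℚ ({β} : Set (AlgebraicClosure ℚ))) := NumberField.mk
  have h3 : Module.finrank ℚ ↥(IntermediateField.adjoin ℚ ({β} : Set (AlgebraicClosure ℚ))) = 3 :=
    AddKatoTwo.finrank_adjoin_root_twoTorsionPolynomial_eq_three W hirr hβ
  exact forall_ne_sq_sub_two_mul_sq_of_signCert W hord ht h3 (aeval_four_mul_gen_twoDivisionUCubic W hβ) P k m m' a c hc ha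
    hroot hmm hcert

/-- **`μ₂(ℚ(β)^{cyc}) = 0` OFF THE STRATUM BY CHEVALLEY'S DOOR, UNIT BIT IN CERTIFICATE FORM.** att-p5 g28's
`classicalMuVanishes_adjoin_of_chevalley_of_not_onKilfordStratumAtTwo` with its INFINITE hypothesis `hnn : ∀ a b, ε ≠ a² − 2b²` replaced by the
`2`-adic sign certificate of the unit `ε = P(4β)/(2^k m)` (integers `P, k, m, m', a, c` + decidable congruences). Displayed per curve: `h(ℚ(β))` odd,
the unit `ε ∈ 𝓞 ℚ(β)` with its coordinates. [cite: Lang1990, Ch. 13 §4, Lemma 4.1] [cite: Fukuda1994, Thm. 1 (1), p. 264]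
[cite: Serre1973, Ch. III §1.2 Thm. 1] -/
theorem classicalMuVanishes_adjoin_of_chevalleySign_of_not_onKilfordStratumAtTwo (hord : IsOrdinaryAt W 2)
    (ht : ∀ x : ℚ, ¬ HasRationalTwoTorsionX W x) (hs : ¬ OnKilfordStratumAtTwo W)
    {β : AlgebraicClosure ℚ} (hβ : aeval β W.twoTorsionPolynomial.toPoly = 0)
    (hh : haveI : FiniteDimensional ℚ ↥(IntermediateField.adjoin ℚ ({β} : Set (AlgebraicClosure ℚ))) :=
        IntermediateField.adjoin.finiteDimensional ((AlgebraicClosure.isAlgebraic ℚ).isAlgebraic β).isIntegral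
      haveI : NumberField ↥(IntermediateField.adjoin ℚ ({β} : Set (AlgebraicClosure ℚ))) := NumberField.mk
      ¬ 2 ∣ classNumber ↥(IntermediateField.adjoin ℚ ({β} : Set (AlgebraicClosure ℚ))))
    {ε : 𝓞 ↥(IntermediateField.adjoin ℚ ({β} : Set (AlgebraicClosure ℚ)))} (hεu : IsUnit ε)
    (P : ℤ[X]) (k : ℕ) (m m' a c : ℤ)
    (hε : (ε : ↥(IntermediateField.adjoin ℚ ({β} : Set (AlgebraicClosure ℚ)))) =
      aeval (4 * (AdjoinSimple.gen ℚ β : ↥(IntermediateField.adjoin ℚ ({β} : Set (AlgebraicClosure ℚ)))))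
          (P.map (Int.castRingHom ℚ)) / (2 ^ k * (m : ↥(IntermediateField.adjoin ℚ ({β} : Set (AlgebraicClosure ℚ))))))
    (hc : c = 3 ∨ c = 5) (ha : Odd a)
    (hroot : (2 : ℤ) ^ (k + 3) ∣
      a ^ 3 + (integralModelInt W).b₂ * a ^ 2 + 8 * (integralModelInt W).b₄ * a + 16 * (integralModelInt W).b₆)
    (hmm : ((m * m' : ℤ) : ZMod (2 ^ 3)) = 1)
    (hcert : ((P.eval a * m' : ℤ) : ZMod (2 ^ (k + 3))) = ((2 ^ k * c : ℤ) : ZMod (2 ^ (k + 3))))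
    (κP : ZpExtension ↥(IntermediateField.adjoin ℚ ({β} : Set (AlgebraicClosure ℚ))) 2) (hκP : κP.IsCyclotomic) :
    ClassicalMuVanishes κP := by
  refine classicalMuVanishes_adjoin_of_chevalley_of_not_onKilfordStratumAtTwo W hord ht hs hβ hh hεu ?_ κP hκP
  rw [hε]
  exact forall_ne_sq_sub_two_mul_sq_adjoin_of_signCert W hord ht hβ P k m m' a c hc ha hroot hmm hcert

/-- **THE OFF-STRATUM DOOR INTO `MC₂(W)` BY CHEVALLEY, UNIT BIT IN CERTIFICATE FORM.** PRINT⁵ {Kato 17.4 (1)(2) at `2` (`h17`), Greenberg 4.1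
(`hGr`), period unit (`hper`), modularity (`hmod`), GZK (`hGZK`)} + MuIneqʳ (`hI`, the registered stub VERBATIM) + the cell hypotheses (good
ordinary at `2`, no rational `2`-torsion abscissa, `Δ_W < 0`, `r_an = 0`, analytic `μ₂ = 0` on the even branch, `BSD₂(W)`) + OFF the Kilford stratum +
`β` a root of the `2`-division cubic + `h(ℚ(β))` odd + a unit `ε = P(4β)/(2^k m)` of `𝓞 ℚ(β)` with its `2`-ADIC SIGN CERTIFICATE (decidable) ⟹ `MC₂(W)`
(att-p5 g28's door with `hnn` discharged by §3). Uniform on `Δ_min ≡ 3, 5, 7 (mod 8)`. [cite: Fukuda1994, Thm. 1 (1), p. 264]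
[cite: Kato2004Asterisque, Thm. 17.4 (1)(2) (p. 273)] [cite: GreenbergLNM1716, Thm. 4.1 (p. 102) and Conj. 1.11 (p. 58)]
[cite: Iwasawa1973MuInvariants, Thm. 2 and Thm. 3] [cite: Lang1990, Ch. 13 §4, Lemma 4.1] [cite: Serre1973, Ch. III §1.2 Thm. 1] -/
theorem mazurMainConjecture_two_of_muIneqRel_of_chevalleySign_of_not_onKilfordStratumAtTwo
    (h17 : ∀ [NeZero (W.conductorNorm ℤ)] (f : CuspForm (Gamma0 (W.conductorNorm ℤ)) 2),
      kato_divisibility_allPrimes W 2 (f := f))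
    (hGr : Greenberg1999.thm41_charValue_rankZero_anyPrime)
    (hper : realPeriodRat_eq_unit_mul_plusPeriod_two) (hmod : nonempty_modularParametrizationData)
    (hGZK : rank_eq_analyticRank_of_analyticRank_le_one)
    (hI : ∀ (W : WeierstrassCurve ℚ) [W.IsElliptic] [W.IsGloballyMinimal], IsOrdinaryAt W 2 →
      (∀ x : ℚ, ¬ HasRationalTwoTorsionX W x) →
      ∀ (κ : ZpExtension ℚ 2) (γ : Field.absoluteGaloisGroup ℚ), κ.IsCyclotomic →
      κ.IsTopGenerator γ → IsCyclotomicVariable 2 γ →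
      ∀ ⦃N : ℕ⦄ [NeZero N] (f : CuspForm (Gamma0 N) 2), IsNewformOf W f →
      ∀ Gp : IwasawaAlgebra 2, iwasawaToPowerSeries 2 Gp = padicLFunction f (unitRoot W 2 : ℚ_[2]) →
      ∀ (D : W.SelmerDualData κ γ) (Yr : W.FineSelmerDualDataRelaxedInf κ γ),
        lengthAt (IwasawaAlgebra 2) D.X ⟨IwasawaAlgebra.augIdealP 2, IwasawaAlgebra.isPrime_augIdealP_holds 2⟩ ≤
          lengthAt (IwasawaAlgebra 2) (IwasawaAlgebra 2 ⧸ Ideal.span {Gp})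
              ⟨IwasawaAlgebra.augIdealP 2, IwasawaAlgebra.isPrime_augIdealP_holds 2⟩ +
            lengthAt (IwasawaAlgebra 2) Yr.X ⟨IwasawaAlgebra.augIdealP 2, IwasawaAlgebra.isPrime_augIdealP_holds 2⟩)
    (hord : IsOrdinaryAt W 2) (ht : ∀ x : ℚ, ¬ HasRationalTwoTorsionX W x) (hΔ : W.Δ < 0) (hr : W.analyticRank = 0)
    (hμan : ∀ ⦃N : ℕ⦄ [NeZero N] (f : CuspForm (Gamma0 N) 2), IsNewformOf W f →
      ∀ G : IwasawaAlgebra 2, IsEvenBranchLiftAtTwo W f G → red G ≠ 0)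
    (hbsd : BSDp W 2) (hs : ¬ OnKilfordStratumAtTwo W)
    {β : AlgebraicClosure ℚ} (hβ : aeval β W.twoTorsionPolynomial.toPoly = 0)
    (hh : haveI : FiniteDimensional ℚ ↥(IntermediateField.adjoin ℚ ({β} : Set (AlgebraicClosure ℚ))) :=
        IntermediateField.adjoin.finiteDimensional ((AlgebraicClosure.isAlgebraic ℚ).isAlgebraic β).isIntegral
      haveI : NumberField ↥(IntermediateField.adjoin ℚ ({β} : Set (AlgebraicClosure ℚ))) := NumberField.mk
      ¬ 2 ∣ classNumber ↥(IntermediateField.adjoin ℚ ({β} : Set (AlgebraicClosure ℚ))))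
    {ε : 𝓞 ↥(IntermediateField.adjoin ℚ ({β} : Set (AlgebraicClosure ℚ)))} (hεu : IsUnit ε)
    (P : ℤ[X]) (k : ℕ) (m m' a c : ℤ)
    (hε : (ε : ↥(IntermediateField.adjoin ℚ ({β} : Set (AlgebraicClosure ℚ)))) =
      aeval (4 * (AdjoinSimple.gen ℚ β : ↥(IntermediateField.adjoin ℚ ({β} : Set (AlgebraicClosure ℚ)))))
          (P.map (Int.castRingHom ℚ)) / (2 ^ k * (m : ↥(IntermediateField.adjoin ℚ ({β} : Set (AlgebraicClosure ℚ))))))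
    (hc : c = 3 ∨ c = 5) (ha : Odd a)
    (hroot : (2 : ℤ) ^ (k + 3) ∣
      a ^ 3 + (integralModelInt W).b₂ * a ^ 2 + 8 * (integralModelInt W).b₄ * a + 16 * (integralModelInt W).b₆)
    (hmm : ((m * m' : ℤ) : ZMod (2 ^ 3)) = 1)
    (hcert : ((P.eval a * m' : ℤ) : ZMod (2 ^ (k + 3))) = ((2 ^ k * c : ℤ) : ZMod (2 ^ (k + 3)))) :
    MazurMainConjecture W 2 :=
  mazurMainConjecture_two_of_muIneqRel_of_classicalMu_cubicField_of_Δ_neg W h17 hGr hper hmod hGZK hI hord ht hΔ hr hμan hbsd hβ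
    fun κP hκP => classicalMuVanishes_adjoin_of_chevalleySign_of_not_onKilfordStratumAtTwo W hord ht hs hβ hh hεu P k m m' a c hε hc
      ha hroot hmm hcert κP hκP

end Adjoin

/-! ## §2 The fully decidable doors: `h(ℚ(β))` odd + integers -/

section Decidable

open CongruenceSubgroup Literature.NumberTheory.IwasawaTheory Literature.NumberTheory.GaloisRepresentations
  Literature.NumberTheory.EllipticCurves.ModularForms Literature.NumberTheory.EllipticCurves.Rank1Residual
  Literature.NumberTheory.EllipticCurves.Module
  Summit.BirchSwinnertonDyer.Rank1Residual Summit.BirchSwinnertonDyer.Rank1Residual.X1.MuLambda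
  Summit.BirchSwinnertonDyer.Rank1Residual.X5
  Summit.BirchSwinnertonDyer.BirchSwinnertonDyer.Theorems.Rank1ResidualX1Defs
  Summit.BirchSwinnertonDyer.BirchSwinnertonDyer.Theses.AlignedTransportAtTwo
  Summit.BirchSwinnertonDyer.BirchSwinnertonDyer.Theorems.AlignedTransportAtTwoCubicKilfordPrimes
  Summit.BirchSwinnertonDyer.BirchSwinnertonDyer.Theorems.AlignedTransportAtTwoCubicCarrierRoad
  Summit.BirchSwinnertonDyer.BirchSwinnertonDyer.Theorems.AlignedTransportAtTwoCubicOffStratumFukudaIndexDoors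

variable (W : WeierstrassCurve ℚ) [W.IsElliptic] [W.IsGloballyMinimal]

/-- **`μ₂(ℚ(β)^{cyc}) = 0` OFF THE STRATUM FROM `h(ℚ(β))` ODD AND INTEGERS ONLY.** The Chevalley `(0,1)` door with BOTH unit inputs certified:
`ε = P(4β)/(2^k m)` with its cubic unit equation `ε³ − Tε² + Sε − sgn = 0` in `ℚ(β)` (`sgn = ±1`; one `linear_combination` per row) and its `2`-adic
sign certificate `(a, m', c)` (decidable congruences). Displayed per curve: `h(ℚ(β))` odd — nothing else that is not an integer.
[cite: Lang1990, Ch. 13 §4, Lemma 4.1] [cite: Fukuda1994, Thm. 1 (1), p. 264] [cite: Serre1973, Ch. III §1.2 Thm. 1] -/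
theorem classicalMuVanishes_adjoin_of_unitCerts_of_not_onKilfordStratumAtTwo (hord : IsOrdinaryAt W 2)
    (ht : ∀ x : ℚ, ¬ HasRationalTwoTorsionX W x) (hs : ¬ OnKilfordStratumAtTwo W)
    {β : AlgebraicClosure ℚ} (hβ : aeval β W.twoTorsionPolynomial.toPoly = 0)
    (hh : haveI : FiniteDimensional ℚ ↥(IntermediateField.adjoin ℚ ({β} : Set (AlgebraicClosure ℚ))) :=
        IntermediateField.adjoin.finiteDimensional ((AlgebraicClosure.isAlgebraic ℚ).isAlgebraic β).isIntegral
      haveI : NumberField ↥(IntermediateField.adjoin ℚ ({β} : Set (AlgebraicClosure ℚ))) := NumberField.mk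
      ¬ 2 ∣ classNumber ↥(IntermediateField.adjoin ℚ ({β} : Set (AlgebraicClosure ℚ))))
    (P : ℤ[X]) (k : ℕ) (m m' a c T S sgn : ℤ) (hsgn : sgn = 1 ∨ sgn = -1)
    (hid : (aeval (4 * (AdjoinSimple.gen ℚ β : ↥(IntermediateField.adjoin ℚ ({β} : Set (AlgebraicClosure ℚ)))))
          (P.map (Int.castRingHom ℚ)) / (2 ^ k * (m : ↥(IntermediateField.adjoin ℚ ({β} : Set (AlgebraicClosure ℚ)))))) ^ 3
        - T * (aeval (4 * (AdjoinSimple.gen ℚ β : ↥(IntermediateField.adjoin ℚ ({β} : Set (AlgebraicClosure ℚ)))))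
          (P.map (Int.castRingHom ℚ)) / (2 ^ k * (m : ↥(IntermediateField.adjoin ℚ ({β} : Set (AlgebraicClosure ℚ)))))) ^ 2
        + S * (aeval (4 * (AdjoinSimple.gen ℚ β : ↥(IntermediateField.adjoin ℚ ({β} : Set (AlgebraicClosure ℚ)))))
          (P.map (Int.castRingHom ℚ)) / (2 ^ k * (m : ↥(IntermediateField.adjoin ℚ ({β} : Set (AlgebraicClosure ℚ))))))
        - sgn = 0)
    (hc : c = 3 ∨ c = 5) (ha : Odd a)
    (hroot : (2 : ℤ) ^ (k + 3) ∣
      a ^ 3 + (integralModelInt W).b₂ * a ^ 2 + 8 * (integralModelInt W).b₄ * a + 16 * (integralModelInt W).b₆)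
    (hmm : ((m * m' : ℤ) : ZMod (2 ^ 3)) = 1)
    (hcert : ((P.eval a * m' : ℤ) : ZMod (2 ^ (k + 3))) = ((2 ^ k * c : ℤ) : ZMod (2 ^ (k + 3))))
    (κP : ZpExtension ↥(IntermediateField.adjoin ℚ ({β} : Set (AlgebraicClosure ℚ))) 2) (hκP : κP.IsCyclotomic) :
    ClassicalMuVanishes κP := by
  have hirr := AlignedTransportAtTwoSeed.irr_two_of_forall_not_hasRationalTwoTorsionX W ht
  have hβint : IsIntegral ℚ β := ((AlgebraicClosure.isAlgebraic ℚ).isAlgebraic β).isIntegral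
  haveI : FiniteDimensional ℚ ↥(IntermediateField.adjoin ℚ ({β} : Set (AlgebraicClosure ℚ))) :=
    IntermediateField.adjoin.finiteDimensional hβint
  haveI : NumberField ↥(IntermediateField.adjoin ℚ ({β} : Set (AlgebraicClosure ℚ))) := NumberField.mk
  have h3 : Module.finrank ℚ ↥(IntermediateField.adjoin ℚ ({β} : Set (AlgebraicClosure ℚ))) = 3 :=
    AddKatoTwo.finrank_adjoin_root_twoTorsionPolynomial_eq_three W hirr hβ
  obtain ⟨η, hηu, hη, hnn⟩ := exists_isUnit_forall_ne_sq_sub_two_mul_sq_of_certs W hord ht h3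
    (aeval_four_mul_gen_twoDivisionUCubic W hβ) P k m m' a c T S sgn hsgn hid hc ha hroot hmm hcert
  exact classicalMuVanishes_adjoin_of_chevalley_of_not_onKilfordStratumAtTwo W hord ht hs hβ hh hηu hnn κP hκP

/-- **THE OFF-STRATUM DOOR INTO `MC₂(W)` FROM `h(ℚ(β))` ODD AND INTEGERS ONLY.** PRINT⁵ + MuIneqʳ (registered stub VERBATIM) + the cell hypotheses
(`Δ_W < 0`) + OFF the Kilford stratum + `β` a root of the `2`-division cubic + `h(ℚ(β))` odd + the unit `ε = P(4β)/(2^k m)` given by INTEGERS with its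
cubic unit equation (one field identity) and its `2`-adic sign certificate (decidable) ⟹ `MC₂(W)`. Uniform on `Δ_min ≡ 3, 5, 7 (mod 8)`.
[cite: Fukuda1994, Thm. 1 (1), p. 264] [cite: Kato2004Asterisque, Thm. 17.4 (1)(2) (p. 273)] [cite: GreenbergLNM1716, Thm. 4.1 (p. 102) and Conj. 1.11 (p. 58)]
[cite: Iwasawa1973MuInvariants, Thm. 2 and Thm. 3] [cite: Lang1990, Ch. 13 §4, Lemma 4.1] [cite: Serre1973, Ch. III §1.2 Thm. 1] -/
theorem mazurMainConjecture_two_of_muIneqRel_of_unitCerts_of_not_onKilfordStratumAtTwo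
    (h17 : ∀ [NeZero (W.conductorNorm ℤ)] (f : CuspForm (Gamma0 (W.conductorNorm ℤ)) 2),
      kato_divisibility_allPrimes W 2 (f := f))
    (hGr : Greenberg1999.thm41_charValue_rankZero_anyPrime)
    (hper : realPeriodRat_eq_unit_mul_plusPeriod_two) (hmod : nonempty_modularParametrizationData)
    (hGZK : rank_eq_analyticRank_of_analyticRank_le_one)
    (hI : ∀ (W : WeierstrassCurve ℚ) [W.IsElliptic] [W.IsGloballyMinimal], IsOrdinaryAt W 2 →
      (∀ x : ℚ, ¬ HasRationalTwoTorsionX W x) →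
      ∀ (κ : ZpExtension ℚ 2) (γ : Field.absoluteGaloisGroup ℚ), κ.IsCyclotomic →
      κ.IsTopGenerator γ → IsCyclotomicVariable 2 γ →
      ∀ ⦃N : ℕ⦄ [NeZero N] (f : CuspForm (Gamma0 N) 2), IsNewformOf W f →
      ∀ Gp : IwasawaAlgebra 2, iwasawaToPowerSeries 2 Gp = padicLFunction f (unitRoot W 2 : ℚ_[2]) →
      ∀ (D : W.SelmerDualData κ γ) (Yr : W.FineSelmerDualDataRelaxedInf κ γ),
        lengthAt (IwasawaAlgebra 2) D.X ⟨IwasawaAlgebra.augIdealP 2, IwasawaAlgebra.isPrime_augIdealP_holds 2⟩ ≤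
          lengthAt (IwasawaAlgebra 2) (IwasawaAlgebra 2 ⧸ Ideal.span {Gp})
              ⟨IwasawaAlgebra.augIdealP 2, IwasawaAlgebra.isPrime_augIdealP_holds 2⟩ +
            lengthAt (IwasawaAlgebra 2) Yr.X ⟨IwasawaAlgebra.augIdealP 2, IwasawaAlgebra.isPrime_augIdealP_holds 2⟩)
    (hord : IsOrdinaryAt W 2) (ht : ∀ x : ℚ, ¬ HasRationalTwoTorsionX W x) (hΔ : W.Δ < 0) (hr : W.analyticRank = 0)
    (hμan : ∀ ⦃N : ℕ⦄ [NeZero N] (f : CuspForm (Gamma0 N) 2), IsNewformOf W f →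
      ∀ G : IwasawaAlgebra 2, IsEvenBranchLiftAtTwo W f G → red G ≠ 0)
    (hbsd : BSDp W 2) (hs : ¬ OnKilfordStratumAtTwo W)
    {β : AlgebraicClosure ℚ} (hβ : aeval β W.twoTorsionPolynomial.toPoly = 0)
    (hh : haveI : FiniteDimensional ℚ ↥(IntermediateField.adjoin ℚ ({β} : Set (AlgebraicClosure ℚ))) :=
        IntermediateField.adjoin.finiteDimensional ((AlgebraicClosure.isAlgebraic ℚ).isAlgebraic β).isIntegral
      haveI : NumberField ↥(IntermediateField.adjoin ℚ ({β} : Set (AlgebraicClosure ℚ))) := NumberField.mk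
      ¬ 2 ∣ classNumber ↥(IntermediateField.adjoin ℚ ({β} : Set (AlgebraicClosure ℚ))))
    (P : ℤ[X]) (k : ℕ) (m m' a c T S sgn : ℤ) (hsgn : sgn = 1 ∨ sgn = -1)
    (hid : (aeval (4 * (AdjoinSimple.gen ℚ β : ↥(IntermediateField.adjoin ℚ ({β} : Set (AlgebraicClosure ℚ)))))
          (P.map (Int.castRingHom ℚ)) / (2 ^ k * (m : ↥(IntermediateField.adjoin ℚ ({β} : Set (AlgebraicClosure ℚ)))))) ^ 3
        - T * (aeval (4 * (AdjoinSimple.gen ℚ β : ↥(IntermediateField.adjoin ℚ ({β} : Set (AlgebraicClosure ℚ)))))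
          (P.map (Int.castRingHom ℚ)) / (2 ^ k * (m : ↥(IntermediateField.adjoin ℚ ({β} : Set (AlgebraicClosure ℚ)))))) ^ 2
        + S * (aeval (4 * (AdjoinSimple.gen ℚ β : ↥(IntermediateField.adjoin ℚ ({β} : Set (AlgebraicClosure ℚ)))))
          (P.map (Int.castRingHom ℚ)) / (2 ^ k * (m : ↥(IntermediateField.adjoin ℚ ({β} : Set (AlgebraicClosure ℚ))))))
        - sgn = 0)
    (hc : c = 3 ∨ c = 5) (ha : Odd a)
    (hroot : (2 : ℤ) ^ (k + 3) ∣
      a ^ 3 + (integralModelInt W).b₂ * a ^ 2 + 8 * (integralModelInt W).b₄ * a + 16 * (integralModelInt W).b₆)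
    (hmm : ((m * m' : ℤ) : ZMod (2 ^ 3)) = 1)
    (hcert : ((P.eval a * m' : ℤ) : ZMod (2 ^ (k + 3))) = ((2 ^ k * c : ℤ) : ZMod (2 ^ (k + 3)))) :
    MazurMainConjecture W 2 :=
  mazurMainConjecture_two_of_muIneqRel_of_classicalMu_cubicField_of_Δ_neg W h17 hGr hper hmod hGZK hI hord ht hΔ hr hμan hbsd hβ
    fun κP hκP => classicalMuVanishes_adjoin_of_unitCerts_of_not_onKilfordStratumAtTwo W hord ht hs hβ hh P k m m' a c T S sgn
      hsgn hid hc ha hroot hmm hcert κP hκP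


/-- **THE OFF-STRATUM DOOR FROM `h(ℚ(β))` ODD AND INTEGERS, decidable stratum test**: the same with `Δ_min(W) % 8 ≠ 1` in place of «OFF the
Kilford stratum» (tree `not_onKilfordStratumAtTwo_iff_minimalDiscriminantInt_emod_eight_ne`). Every displayed non-PRINT input except `h(ℚ(β))` odd
is now an integer condition. [cite: Serre1973, Ch. II §3.3 Thm. 4 and Ch. III §1.2 Thm. 1] [cite: Fukuda1994, Thm. 1 (1), p. 264]
[cite: Kato2004Asterisque, Thm. 17.4 (1)(2) (p. 273)] [cite: Lang1990, Ch. 13 §4, Lemma 4.1] -/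
theorem mazurMainConjecture_two_of_muIneqRel_of_unitCerts_of_minimalDiscriminantInt_emod_eight_ne_one
    (h17 : ∀ [NeZero (W.conductorNorm ℤ)] (f : CuspForm (Gamma0 (W.conductorNorm ℤ)) 2),
      kato_divisibility_allPrimes W 2 (f := f))
    (hGr : Greenberg1999.thm41_charValue_rankZero_anyPrime)
    (hper : realPeriodRat_eq_unit_mul_plusPeriod_two) (hmod : nonempty_modularParametrizationData)
    (hGZK : rank_eq_analyticRank_of_analyticRank_le_one)
    (hI : ∀ (W : WeierstrassCurve ℚ) [W.IsElliptic] [W.IsGloballyMinimal], IsOrdinaryAt W 2 →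
      (∀ x : ℚ, ¬ HasRationalTwoTorsionX W x) →
      ∀ (κ : ZpExtension ℚ 2) (γ : Field.absoluteGaloisGroup ℚ), κ.IsCyclotomic →
      κ.IsTopGenerator γ → IsCyclotomicVariable 2 γ →
      ∀ ⦃N : ℕ⦄ [NeZero N] (f : CuspForm (Gamma0 N) 2), IsNewformOf W f →
      ∀ Gp : IwasawaAlgebra 2, iwasawaToPowerSeries 2 Gp = padicLFunction f (unitRoot W 2 : ℚ_[2]) →
      ∀ (D : W.SelmerDualData κ γ) (Yr : W.FineSelmerDualDataRelaxedInf κ γ),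
        lengthAt (IwasawaAlgebra 2) D.X ⟨IwasawaAlgebra.augIdealP 2, IwasawaAlgebra.isPrime_augIdealP_holds 2⟩ ≤
          lengthAt (IwasawaAlgebra 2) (IwasawaAlgebra 2 ⧸ Ideal.span {Gp})
              ⟨IwasawaAlgebra.augIdealP 2, IwasawaAlgebra.isPrime_augIdealP_holds 2⟩ +
            lengthAt (IwasawaAlgebra 2) Yr.X ⟨IwasawaAlgebra.augIdealP 2, IwasawaAlgebra.isPrime_augIdealP_holds 2⟩)
    (hord : IsOrdinaryAt W 2) (ht : ∀ x : ℚ, ¬ HasRationalTwoTorsionX W x) (hΔ : W.Δ < 0) (hr : W.analyticRank = 0)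
    (hμan : ∀ ⦃N : ℕ⦄ [NeZero N] (f : CuspForm (Gamma0 N) 2), IsNewformOf W f →
      ∀ G : IwasawaAlgebra 2, IsEvenBranchLiftAtTwo W f G → red G ≠ 0)
    (hbsd : BSDp W 2) (h8 : minimalDiscriminantInt W % 8 ≠ 1)
    {β : AlgebraicClosure ℚ} (hβ : aeval β W.twoTorsionPolynomial.toPoly = 0)
    (hh : haveI : FiniteDimensional ℚ ↥(IntermediateField.adjoin ℚ ({β} : Set (AlgebraicClosure ℚ))) :=
        IntermediateField.adjoin.finiteDimensional ((AlgebraicClosure.isAlgebraic ℚ).isAlgebraic β).isIntegral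
      haveI : NumberField ↥(IntermediateField.adjoin ℚ ({β} : Set (AlgebraicClosure ℚ))) := NumberField.mk
      ¬ 2 ∣ classNumber ↥(IntermediateField.adjoin ℚ ({β} : Set (AlgebraicClosure ℚ))))
    (P : ℤ[X]) (k : ℕ) (m m' a c T S sgn : ℤ) (hsgn : sgn = 1 ∨ sgn = -1)
    (hid : (aeval (4 * (AdjoinSimple.gen ℚ β : ↥(IntermediateField.adjoin ℚ ({β} : Set (AlgebraicClosure ℚ)))))
          (P.map (Int.castRingHom ℚ)) / (2 ^ k * (m : ↥(IntermediateField.adjoin ℚ ({β} : Set (AlgebraicClosure ℚ)))))) ^ 3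
        - T * (aeval (4 * (AdjoinSimple.gen ℚ β : ↥(IntermediateField.adjoin ℚ ({β} : Set (AlgebraicClosure ℚ)))))
          (P.map (Int.castRingHom ℚ)) / (2 ^ k * (m : ↥(IntermediateField.adjoin ℚ ({β} : Set (AlgebraicClosure ℚ)))))) ^ 2
        + S * (aeval (4 * (AdjoinSimple.gen ℚ β : ↥(IntermediateField.adjoin ℚ ({β} : Set (AlgebraicClosure ℚ)))))
          (P.map (Int.castRingHom ℚ)) / (2 ^ k * (m : ↥(IntermediateField.adjoin ℚ ({β} : Set (AlgebraicClosure ℚ))))))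
        - sgn = 0)
    (hc : c = 3 ∨ c = 5) (ha : Odd a)
    (hroot : (2 : ℤ) ^ (k + 3) ∣
      a ^ 3 + (integralModelInt W).b₂ * a ^ 2 + 8 * (integralModelInt W).b₄ * a + 16 * (integralModelInt W).b₆)
    (hmm : ((m * m' : ℤ) : ZMod (2 ^ 3)) = 1)
    (hcert : ((P.eval a * m' : ℤ) : ZMod (2 ^ (k + 3))) = ((2 ^ k * c : ℤ) : ZMod (2 ^ (k + 3)))) :
    MazurMainConjecture W 2 :=
  mazurMainConjecture_two_of_muIneqRel_of_unitCerts_of_not_onKilfordStratumAtTwo W h17 hGr hper hmod hGZK hI hord ht hΔ hr hμan hbsd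
    ((not_onKilfordStratumAtTwo_iff_minimalDiscriminantInt_emod_eight_ne W hord).mpr h8) hβ hh P k m m' a c T S sgn hsgn hid hc ha hroot
    hmm hcert

end Decidable

end Summit.BirchSwinnertonDyer.BirchSwinnertonDyer.Theorems.AlignedTransportAtTwoCubicChevalleyUnitSignDoors

end
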